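import Mathlib
import Summits.Ventures.PercRepro2.SepSplitIter

/-!
# Gluing at a general separator, XI: the TENSOR form of the domain Markov identity — both sides
sorted by their data, the kernel contracted between them, and the two-level contraction (blind
cell PercRepro2, mine-2 g49, 2026-08-29; `conjectures/MINE-2.md` M2-101; g48's successor item (i))

At a split of the terminals `Z : ζ → V` across a separator `σ : ι → V`, the identity
`typedCount_eq_sepSplitT` sorts the copies by their FAR data; sorting the root side by its data as
well (`sum_exactT` on the root side, `rootKT_eq_sum_side`) gives the symmetric **tensor form**
`typedCount_eq_tensorT`:
`typedCount F z τ (KZ ∘ connData) = Σ_{pL} Σ_{pH} cntL(pL) · cntH(pH) · KZ(glued(pH, pL))`,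
where `cntL(pL) = typedCount A z τ (farKT VL pL)` and `cntH(pH) = typedCount B z τ (farKT VH pH)`
are the exact-data counts of the two sides (the same kind of object on both sides) and
`gluedKT KZ side pH pL = KZ (gluedT pH₁ pL₁ side) (gluedT pH₂ pL₂ side) (gluedT pH₃ pL₃ side)` is
the kernel on the glued connectivities — the inert factor is `1` under a split
(`sdiff_sides_eq_empty_of_sepSplitT`).  Each side count is a typed count of a terminal kernel of
the connectivity of `S ∪ Z` on that side with the pinning restricted to it
(`farCount_sideF_eq_typedCount_connData`), so the tensor identity applies to it again at a
separator of that side: **`typedCount_eq_tensorT_two`**, the two-level contraction (a far side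
split once more at `σ'`: four side counts and two kernel tensors; the data types of the second
level are larger, hence the raised `synthInstance.maxSize`).  The marks' row 2′TRI is the
case `ζ = Fin 5`, `KZ = KB ∘ st7` (`typedCount_K3_eq_tensor`).  Own work; standard axioms.
-/

namespace Summit.Ventures.PercRepro2

open UnionCluster

namespace CovForm

namespace RootBridge

open OneTyped TypedA3 Untouched TypedFactor Separated

/-! ## The inert factor of a terminal split is one -/

section InertT

open Classical

variable {V : Type*} {E : Type*} {ι ζ : Type*} [Fintype E] [DecidableEq E] {R : Type*} [Field R]
variable (ends : E → Sym2 V) (Z : ζ → V) (σ : ι → V)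

omit [Fintype E] in
/-- Under a terminal split every typed edge lies in a side. -/
lemma sdiff_sides_eq_empty_of_sepSplitT {side : ζ → Bool} {VL VH : Set V} {F : Finset E}
    {z : Config E} (h : SepSplitT ends Z σ side VL VH F z) :
    F \ (sideF ends VL F ∪ sideF ends VH F) = ∅ := by
  refine Finset.eq_empty_of_forall_notMem fun e he => ?_
  rw [Finset.mem_sdiff, Finset.mem_union] at he
  obtain ⟨heF, hn⟩ := he
  have hz : zF F z e = true := by simp [zF, heF]
  rcases h.split e hz with hL | hH
  · exact hn (Or.inl (Finset.mem_filter.mpr ⟨heF, hL⟩))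
  · exact hn (Or.inr (Finset.mem_filter.mpr ⟨heF, hH⟩))

/-- **The terminal identity without the inert factor.** -/
theorem typedCount_eq_sum_far_rootT [Fintype ι] [DecidableEq ι] [Fintype ζ] [DecidableEq ζ]
    (KZ : (ζ → ζ → Bool) → (ζ → ζ → Bool) → (ζ → ζ → Bool) → ℤ) {side : ζ → Bool}
    {VL VH : Set V} (F : Finset E) (z : Config E) (τ : E → ℕ)
    (h : SepSplitT ends Z σ side VL VH F z) :
    typedCount F z τ (fun x y w =>
        ((KZ (connData ends Z x) (connData ends Z y) (connData ends Z w) : ℤ) : R)) =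
      ∑ p : Pat3T ι ζ, typedCount (sideF ends VL F) z τ (farKT ends Z σ VL p) *
        typedCount (sideF ends VH F) z τ (rootKT ends Z σ KZ side VH p) := by
  rw [typedCount_eq_sepSplitT ends Z σ KZ F z τ h, sdiff_sides_eq_empty_of_sepSplitT ends Z σ h,
    typedCount_empty, mul_one]

end InertT

/-! ## The tensor form -/

section Tensor

open Classical

variable {V : Type*} {E : Type*} {ι ζ : Type*} [Fintype E] [DecidableEq E] {R : Type*} [Field R]
variable (ends : E → Sym2 V) (Z : ζ → V) (σ : ι → V)

/-- **The kernel tensor**: the kernel `KZ` on the connectivities glued from a root-side data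
triple `pH` and a far-side data triple `pL`. -/
noncomputable def gluedKT (KZ : (ζ → ζ → Bool) → (ζ → ζ → Bool) → (ζ → ζ → Bool) → ℤ)
    (side : ζ → Bool) (pH pL : Pat3T ι ζ) : ℤ :=
  KZ (gluedT pH.1 pL.1 side) (gluedT pH.2.1 pL.2.1 side) (gluedT pH.2.2 pL.2.2 side)

omit [Fintype E] [DecidableEq E] in
/-- The root-side kernel of a far triple, sorted by the root-side data. -/
lemma rootKT_eq_sum_side [Fintype ι] [DecidableEq ι] [Fintype ζ] [DecidableEq ζ]
    (KZ : (ζ → ζ → Bool) → (ζ → ζ → Bool) → (ζ → ζ → Bool) → ℤ) (side : ζ → Bool) (VH : Set V)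
    (pL : Pat3T ι ζ) (x y w : Config E) :
    rootKT ends Z σ KZ side VH pL x y w =
      ∑ pH : Pat3T ι ζ, (farKT ends Z σ VH pH x y w : R) * ((gluedKT KZ side pH pL : ℤ) : R) := by
  unfold rootKT farKT gluedKT
  have hs := sum_exactT (fun pH : Pat3T ι ζ => KZ (gluedT pH.1 pL.1 side)
      (gluedT pH.2.1 pL.2.1 side) (gluedT pH.2.2 pL.2.2 side))
    (sideDataT ends Z σ (withinRestr ends VH x), sideDataT ends Z σ (withinRestr ends VH y),
      sideDataT ends Z σ (withinRestr ends VH w))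
  simp only at hs
  rw [← hs]
  push_cast
  rfl

/-- The root count of a far triple is the contraction of the root-side counts with the kernel
tensor. -/
lemma typedCount_rootKT_eq_sum_side [Fintype ι] [DecidableEq ι] [Fintype ζ] [DecidableEq ζ]
    (KZ : (ζ → ζ → Bool) → (ζ → ζ → Bool) → (ζ → ζ → Bool) → ℤ) (side : ζ → Bool) (VH : Set V)
    (B : Finset E) (z : Config E) (τ : E → ℕ) (pL : Pat3T ι ζ) :
    typedCount B z τ (rootKT ends Z σ KZ side VH pL : Config E → Config E → Config E → R) =
      ∑ pH : Pat3T ι ζ, typedCount B z τ (farKT ends Z σ VH pH) *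
        ((gluedKT KZ side pH pL : ℤ) : R) := by
  have h1 : typedCount B z τ (rootKT ends Z σ KZ side VH pL : Config E → Config E → Config E → R) =
      typedCount B z τ (fun x y w => ∑ pH : Pat3T ι ζ,
        ((gluedKT KZ side pH pL : ℤ) : R) * farKT ends Z σ VH pH x y w) := by
    refine typedCount_congr' _ _ _ _ _ fun x y w => ?_
    rw [rootKT_eq_sum_side ends Z σ KZ side VH pL x y w]
    exact Finset.sum_congr rfl fun pH _ => mul_comm _ _
  rw [h1, typedCount_sum]
  exact Finset.sum_congr rfl fun pH _ => by
    rw [typedCount_smul', mul_comm]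

/-- **THE TENSOR FORM OF THE DOMAIN MARKOV IDENTITY AT A SEPARATOR**: both sides sorted by their
exact data, the kernel contracted between them —
`typedCount F z τ (KZ ∘ connData) = Σ_{pL} Σ_{pH} cntL(pL) · cntH(pH) · KZ(glued(pH, pL))`. -/
theorem typedCount_eq_tensorT [Fintype ι] [DecidableEq ι] [Fintype ζ] [DecidableEq ζ]
    (KZ : (ζ → ζ → Bool) → (ζ → ζ → Bool) → (ζ → ζ → Bool) → ℤ) {side : ζ → Bool}
    {VL VH : Set V} (F : Finset E) (z : Config E) (τ : E → ℕ)
    (h : SepSplitT ends Z σ side VL VH F z) :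
    typedCount F z τ (fun x y w =>
        ((KZ (connData ends Z x) (connData ends Z y) (connData ends Z w) : ℤ) : R)) =
      ∑ pL : Pat3T ι ζ, ∑ pH : Pat3T ι ζ,
        typedCount (sideF ends VL F) z τ (farKT ends Z σ VL pL) *
          typedCount (sideF ends VH F) z τ (farKT ends Z σ VH pH) *
          ((gluedKT KZ side pH pL : ℤ) : R) := by
  rw [typedCount_eq_sum_far_rootT ends Z σ KZ F z τ h]
  refine Finset.sum_congr rfl fun pL _ => ?_
  rw [typedCount_rootKT_eq_sum_side ends Z σ KZ side VH _ z τ pL, Finset.mul_sum]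
  exact Finset.sum_congr rfl fun pH _ => by ring

end Tensor

/-! ## The two-level contraction -/

section TwoLevel

open Classical

variable {V : Type*} {E : Type*} {ι ι' ζ : Type*} [Fintype E] [DecidableEq E] {R : Type*}
  [Field R]
variable (ends : E → Sym2 V) (Z : ζ → V) (σ : ι → V) (σ' : ι' → V)

set_option synthInstance.maxSize 512 in
/-- **THE TWO-LEVEL CONTRACTION**: the far side of a split is split again at `σ'` (its terminals
are the separator vertices and the far terminals, `Sum.elim Z σ`; its pinning is `z` restricted
to `VL`): the typed count is a contraction of FOUR side counts with TWO kernel tensors. -/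
theorem typedCount_eq_tensorT_two [Fintype ι] [DecidableEq ι] [Fintype ι'] [DecidableEq ι']
    [Fintype ζ] [DecidableEq ζ]
    (KZ : (ζ → ζ → Bool) → (ζ → ζ → Bool) → (ζ → ζ → Bool) → ℤ) {side : ζ → Bool}
    {VL VH : Set V} {side' : ζ ⊕ ι → Bool} {VL' VH' : Set V} (F : Finset E) (z : Config E)
    (τ : E → ℕ) (h : SepSplitT ends Z σ side VL VH F z)
    (h' : SepSplitT ends (Sum.elim Z σ) σ' side' VL' VH' (sideF ends VL F)
      (withinRestr ends VL z)) :
    typedCount F z τ (fun x y w =>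
        ((KZ (connData ends Z x) (connData ends Z y) (connData ends Z w) : ℤ) : R)) =
      ∑ pL : Pat3T ι ζ, ∑ pH : Pat3T ι ζ,
        (∑ pL' : Pat3T ι' (ζ ⊕ ι), ∑ pH' : Pat3T ι' (ζ ⊕ ι),
          typedCount (sideF ends VL' (sideF ends VL F)) (withinRestr ends VL z) τ
              (farKT ends (Sum.elim Z σ) σ' VL' pL') *
            typedCount (sideF ends VH' (sideF ends VL F)) (withinRestr ends VL z) τ
              (farKT ends (Sum.elim Z σ) σ' VH' pH') *
            ((gluedKT (exactKT pL) side' pH' pL' : ℤ) : R)) *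
          typedCount (sideF ends VH F) z τ (farKT ends Z σ VH pH) *
          ((gluedKT KZ side pH pL : ℤ) : R) := by
  rw [typedCount_eq_tensorT ends Z σ KZ F z τ h]
  refine Finset.sum_congr rfl fun pL _ => Finset.sum_congr rfl fun pH _ => ?_
  rw [farCount_sideF_eq_typedCount_connData ends Z σ VL F z τ pL,
    typedCount_eq_tensorT ends (Sum.elim Z σ) σ' (exactKT pL) (sideF ends VL F)
      (withinRestr ends VL z) τ h']

end TwoLevel

/-! ## The marks -/

section Marks

open Classical

variable {V : Type*} {E : Type*} {ι : Type*} [Fintype E] [DecidableEq E] {R : Type*} [Field R]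
variable (ends : E → Sym2 V) (mk : Fin 5 → V) (σ : ι → V)

omit [Fintype E] in
/-- A split of the marks is a split of the terminals `mk`. -/
lemma SepSplit.toT {side : Fin 5 → Bool} {VL VH : Set V} {F : Finset E} {z : Config E}
    (h : SepSplit ends mk σ side VL VH F z) : SepSplitT ends mk σ side VL VH F z :=
  ⟨h.split, h.cap, h.noloop, h.rootH, h.farL, h.farsep⟩

/-- The kernel `K₃` of the marks as a kernel of the terminal connectivity. -/
def KZ3 (c₁ c₂ c₃ : Fin 5 → Fin 5 → Bool) : ℤ := KB (st7 c₁) (st7 c₂) (st7 c₃)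

/-- **Row 2′TRI's typed count in tensor form** at any split of the marks. -/
theorem typedCount_K3_eq_tensor [Fintype ι] [DecidableEq ι] {side : Fin 5 → Bool}
    {VL VH : Set V} (F : Finset E) (z : Config E) (τ : E → ℕ)
    (h : SepSplit ends mk σ side VL VH F z) :
    typedCount F z τ
        (K3 ends (mk 0) (mk 1) (mk 2) (mk 3) (mk 4) : Config E → Config E → Config E → R) =
      ∑ pL : Pat3T ι (Fin 5), ∑ pH : Pat3T ι (Fin 5),
        typedCount (sideF ends VL F) z τ (farKT ends mk σ VL pL) *
          typedCount (sideF ends VH F) z τ (farKT ends mk σ VH pH) *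
          ((gluedKT KZ3 side pH pL : ℤ) : R) := by
  rw [← typedCount_eq_tensorT ends mk σ KZ3 F z τ h.toT]
  exact typedCount_congr' _ _ _ _ _ fun x y w => K3_eq_KZ_connData ends mk x y w

end Marks

end RootBridge

end CovForm

end Summit.Ventures.PercRepro2
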